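/-
Copyright (c) 2026 the pub-hodgecm-mathlib formalisation cell (harness21).  Prover seat hodgecm-mathlib-F0P3a-p08 (g20): «S3-ram» seeding wave (LEAD F0P3a-plan (g13);
owner F0P3a-p06 (g15)), (T2) G-side organ (Cnt2′) (chair F0P3a-p07 (g14)), ROW SOCKET (reg) in both parities; 2026-09-02.
-/
import Literature.NumberTheory.Automorphic.UnitaryDepthZeroPieceStrataLatticeTransportRamified    -- ★ p847358 (F0P3a-p05 (g16)): `ncard_fixedBy_{bd,interior_reg}_eq_ncard_selfDual_fixed_ramified`, `vDeep_frame_of_vDeep`, `valued_sigma_sub_self_lt_one`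
import Literature.NumberTheory.Rogawski1990.UnitFundamentalLemmaFrameOfFormCongr                  -- ★ (F0P3a-p04 (g17)): `exists_frame_of_eq_smul_formCongr_antidiagonal` (A hA hframe ↦ e heA hK)
import Literature.NumberTheory.Rogawski1990.UnitaryLatticeTreeTameRamifiedCM                      -- ★ `isTree_latticeGraph_three_tameRamifiedCM`, `natCard_valuedResidueField_eq_of_ramified_CM`
import Literature.NumberTheory.Rogawski1990.DepthZeroKappaTransferTypeTwoRamifiedGSideNhdsEven      -- ★ p847470: the socket vocabulary
import Literature.NumberTheory.Rogawski1990.UnitFundamentalLemmaInertFlickerFrame                  -- ★ `isUnit_two_integer_iff_valued_eq_one`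
import Literature.NumberTheory.Automorphic.UnitaryGroupInertPlaceHyperbolicBasis                   -- ★ `galAdicCompletionMap_galAdicCompletionMap_of_smul_eq`
import Literature.NumberTheory.Automorphic.UnitaryLatticeTreeFixedParentLawRamified                -- (this seat): the lattice PARENT LAW `ncard_selfDual_fixed_levelZero_eq_card_mul_ncard_regularOne` over ★ (D) p847775, ★ (N′) p847815, ★ NO-TV, ★ LevelZero, ★ ROW-C, ★ ROW-R, ★ G1
import HarnessLib

/-!
# (Cnt2′) ROW SOCKET (reg), both parities: `q_v · n_reg(δ) = n_bd(δ)` — the `stub_T2G_reg_{even,odd}_ram` of F0P3a-p07 (g14)'s skeleton are THEOREMS (Rogawski 1990 Prop. 4.9.1;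
# Kottwitz 1986 §3)

Topic `NumberTheory/Rogawski1990`; namespace `Literature.NumberTheory.Rogawski1990`.  THEOREMS ONLY (no definition, no instance, no notation, no named fact, no `sorry`); kernel lane
`--supports stmt-HodgeConjecture-24833`.  Cell `pub/hodgecm-mathlib`, crux H413; road «S3-ram» (count-neutral).  The (Cnt2′) skeleton (HOME `F0/P3a/F0P3a-p07/g14/cnt2/`, v2
f4980431∕1978c9ed) proves the fold's sockets `stub_typeTwo_counts_{even,odd}_ram` over four ROW SOCKETS per parity; ★ p847667 discharged (bd); THIS FILE discharges (reg) in both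
parities with EXACTLY the socket texts `socket-T2G_reg_{even,odd}.F0P3ap07g14.txt` (so the skeleton closes them by
`exact typeTwo_stratumReg_{even,odd}_ram L H' hH' w hw he hH'w hH'i h2 ϖ hϖ hσϖ A hA hframe`).

THE MATHEMATICS ([Rogawski1990] §4.9 Prop. 4.9.1 (a) p. 55; [Kottwitz1986] §3).  For a `v`-deep `δ ∈ G′_v = U(H′)(L⁺_v)` at a tamely ramified non-split place (`δ_w ≡ 1 (ϖ_v)`,
`ϖ_v = ϖ_w²·unit`), the `δ`-fixed cosets `q ∈ G′_v ⧸ K′` are the `δ`-fixed self-dual lattices of `(L_w³, σ_w, Φ₃,w)` along the frame `e : G′_v ≃ U(σ_w, Φ₃)(L_w)` built from the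
socket's `(A, hA, hframe)` (★ `exists_frame_of_eq_smul_formCongr_antidiagonal`), label by label (★ A1′ `ncard_fixedBy_{bd,interior_reg}_eq_ncard_selfDual_fixed_ramified`,
F0P3a-p05 (g16)); `e δ ≡ 1 (ϖ_w²)` (★ `vDeep_frame_of_vDeep`); and in the `J₀`-model the PARENT LAW (★ `ncard_selfDual_fixed_levelZero_eq_card_mul_ncard_regularOne`, this seat)
says `#bd = |𝓀_w| · #reg`; finally `|𝓀_w| = q_v` (★ `natCard_valuedResidueField_eq_of_ramified_CM`, `f(w|v) = 1`).  §1 is the parity-free, literal-generic core (no `γ_H`, no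
discriminant, no `κ`, no matching hypothesis); §2 adds the idle socket binders.
HONEST LABEL: HC_CM is proved only modulo the 2 remaining named inputs (hLiu418 24832, h413 24833) until rung 0 closes; bookkeeping over ★ organs, no books consequence.

## References
* [Rogawski1990] J. D. Rogawski, *Automorphic Representations of Unitary Groups in Three Variables*, Ann. of Math. Stud. 123 (1990), §4.9 Prop. 4.9.1 (a) p. 55, Lemma 4.9.3 p. 56.
* [Kottwitz1986] R. E. Kottwitz, *Base change for unit elements of Hecke algebras*, Compositio Math. 60 (1986), §3 (counting fixed lattices shell by shell).
* [BruhatTits1972] F. Bruhat, J. Tits, *Groupes réductifs sur un corps local I*, Publ. Math. IHÉS 41 (1972), §10.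
* [NeukirchANT1999] J. Neukirch, *Algebraic Number Theory* (1999), Ch. II §4 Prop. (4.3) (`f(w|v) = 1` at a totally ramified place).
-/

set_option autoImplicit false


noncomputable section

open scoped WithZero Matrix MatrixGroups


open MeasureTheory Measure Set Filter Topology NumberField IsDedekindDomain Matrix Polynomial ValuativeRel
open Literature.NumberTheory.Automorphic Literature.NumberTheory.Automorphic.UnitaryGroup
open Literature.NumberTheory.Automorphic.IntegralReduction Literature.NumberTheory.GaloisRepresentations
open Literature.NumberTheory.NumberFields Literature.NumberTheory.QuadraticForms
open Literature.GroupTheory.SpecificGroups Literature.NumberTheory.Automorphic.UnitaryLatticeTree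
open scoped Matrix MatrixGroups ValuativeRel WithZero

namespace Literature.NumberTheory.Rogawski1990

/-! ## §1 The parity-free core: `q_v · n_reg(δ) = n_bd(δ)` for every `v`-deep `δ ∈ G′_v` -/

set_option maxHeartbeats 1600000 in
/-- **`q_v · n_reg(δ) = n_bd(δ)` (CM coset currency; parity-free, literal-generic).**  For a `v`-deep `δ ∈ G′_v` at a tamely ramified non-split place: the number of
`δ`-fixed cosets `q ∈ G′_v ⧸ K′` on which `q⁻¹δq` is residually a regular unipotent (`rank(red − 1) = 2`) is `q_v` times the number on which `q⁻¹δq ≡ 1 (ϖ_w)` with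
`ϖ_w⁻¹(q⁻¹δq − 1)` residually of rank `2` — ★ frame ∘ ★ A1′ transports ∘ ★ PARENT LAW ∘ `|𝓀_w| = q_v`. [cite: Rogawski1990, §4.9 Prop. 4.9.1 (a) p. 55] [cite: Kottwitz1986, §3] -/
theorem absNorm_mul_ncard_rankStratum_reg_eq_ncard_rankStratum_two_ram (L : Type) [Field L] [NumberField L] [IsCMField L] (H' : Matrix (Fin 3) (Fin 3) L)
    {v : HeightOneSpectrum (𝓞 ↥(maximalRealSubfield L))} (w : PlacesOver L v)
    (hw : IsCMField.complexConj L • w.1 = w.1) (he : v.asIdeal.ramificationIdx' w.1.asIdeal ≠ 1)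
    (hH'w : IsUnit (placeForm H' w.1))
    (h2 : IsUnit (2 : 𝒪[(w.1.adicCompletion L)]))
    (ϖ : w.1.adicCompletion L) (hϖ : Valued.v ϖ = WithZero.exp (-1 : ℤ)) (hσϖ : galAdicCompletionMap (L := L) (IsCMField.complexConj L) hw ϖ = -ϖ)
    (A : GL (Fin 3) (w.1.adicCompletion L)) (hA : A ∈ glInt 3 (w.1.adicCompletion L))
    (hframe : placeForm H' w.1 = (-(placeForm H' w.1).det) • formCongr (galAdicCompletionMap (L := L) (IsCMField.complexConj L) hw) A ((StdForm.antidiagonal 3).over (w.1.adicCompletion L)))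
    (δ : ((cmDatum L 3 H').Local v))
    (hdeep : ∀ a b, Valued.v (((toPlace v w (HeckeCharacter.uniformizer ↥(maximalRealSubfield L) v : v.adicCompletion ↥(maximalRealSubfield L))) ^ 1)⁻¹ * ((((δ).val : GL (Fin 3) (UnitaryGroup.LocalRing L v)).val.map (Pi.evalRingHom (fun w' : PlacesOver L v => w'.1.adicCompletion L) w)) a b - (1 : Matrix (Fin 3) (Fin 3) (w.1.adicCompletion L)) a b)) ≤ 1) :
    Ideal.absNorm v.asIdeal *
        {q : (((cmDatum L 3 H').Local v) ⧸ cmLocalIntegralLevel L 3 H' v) | q ∈ MulAction.fixedBy (((cmDatum L 3 H').Local v) ⧸ cmLocalIntegralLevel L 3 H' v) δ ∧ ((redMat (((((q.out⁻¹ * δ * q.out)).val : GL (Fin 3) (UnitaryGroup.LocalRing L v)).val.map (Pi.evalRingHom (fun w' : PlacesOver L v => w'.1.adicCompletion L) w))) - 1).rank = 0 ∧ (redMat (ϖ⁻¹ • (((((q.out⁻¹ * δ * q.out)).val : GL (Fin 3) (UnitaryGroup.LocalRing L v)).val.map (Pi.evalRingHom (fun w' : PlacesOver L v => w'.1.adicCompletion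 L) w)) - 1))).rank = 2)}.ncard =
      {q : (((cmDatum L 3 H').Local v) ⧸ cmLocalIntegralLevel L 3 H' v) | q ∈ MulAction.fixedBy (((cmDatum L 3 H').Local v) ⧸ cmLocalIntegralLevel L 3 H' v) δ ∧ (redMat (((((q.out⁻¹ * δ * q.out)).val : GL (Fin 3) (UnitaryGroup.LocalRing L v)).val.map (Pi.evalRingHom (fun w' : PlacesOver L v => w'.1.adicCompletion L) w))) - 1).rank = 2}.ncard := by
  have hc1 : IsCMField.complexConj L ≠ 1 := IsCMField.complexConj_ne_one L
  -- the frame `e : G′_v ≃ₜ* U(σ_w, Φ₃)(L_w)` from `(A, hA, hframe)`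
  obtain ⟨e, heA, hK, -⟩ := exists_frame_of_eq_smul_formCongr_antidiagonal L H' w hw hH'w A hA hframe
  -- CM cosets ↦ fixed self-dual lattices of `(L_w³, σ_w, Φ₃,w)` (★ A1′ part 2, bd and reg)
  rw [ncard_fixedBy_bd_eq_ncard_selfDual_fixed_ramified L H' w hw he h2 ϖ hϖ A hA e heA hK δ hdeep,
    ncard_fixedBy_interior_reg_eq_ncard_selfDual_fixed_ramified L H' w hw he h2 ϖ hϖ A hA e heA hK δ hdeep]
  -- the J₀-model: `Φ₃,w = J₀`
  have h2v : Valued.v (2 : w.1.adicCompletion L) = 1 := (isUnit_two_integer_iff_valued_eq_one (L := L) w.1).1 h2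
  have hσ : ∀ x, (galAdicCompletionMap (L := L) (IsCMField.complexConj L) hw) ((galAdicCompletionMap (L := L) (IsCMField.complexConj L) hw) x) = x :=
    fun x => galAdicCompletionMap_galAdicCompletionMap_of_smul_eq (IsCMField.complexConj L) w hc1 hw x
  have hvσ : ∀ a, Valued.v ((galAdicCompletionMap (L := L) (IsCMField.complexConj L) hw) a) = Valued.v a :=
    fun a => valued_galAdicCompletionMap (L := L) (IsCMField.complexConj L) hw a
  have hres := valued_sigma_sub_self_lt_one L w hw he
  have hT := isTree_latticeGraph_three_tameRamifiedCM L v w hw he h2v hϖ hσϖ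
  let γ : ↥(unitaryGroupOfForm (galAdicCompletionMap (L := L) (IsCMField.complexConj L) hw) ((StdForm.antidiagonal 3).over (w.1.adicCompletion L))) :=
    ⟨((e δ : ↥(unitaryGroupOfForm (galAdicCompletionMap (L := L) (IsCMField.complexConj L) hw) (placeForm (Matrix.of fun i j : Fin 3 => if i.val + j.val + 1 = 3 then (1 : L) else 0) w.1))) : GL (Fin 3) (w.1.adicCompletion L)),
      by rw [← placeForm_antidiagOne]; exact (e δ).2⟩
  have hγe : ((e δ : ↥(unitaryGroupOfForm (galAdicCompletionMap (L := L) (IsCMField.complexConj L) hw) (placeForm (Matrix.of fun i j : Fin 3 => if i.val + j.val + 1 = 3 then (1 : L) else 0) w.1))) : GL (Fin 3) (w.1.adicCompletion L)) = (γ : GL (Fin 3) (w.1.adicCompletion L)) := rfl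
  rw [hγe, placeForm_antidiagOne]
  -- `γ ≡ 1 (ϖ²)`
  have hϖ0 : ϖ ≠ 0 := by intro h0; rw [h0, map_zero] at hϖ; exact WithZero.coe_ne_zero hϖ.symm
  have hγ2 : ∀ i j, Valued.v ((((γ : GL (Fin 3) (w.1.adicCompletion L)) : Matrix (Fin 3) (Fin 3) (w.1.adicCompletion L)) - 1) i j) ≤ Valued.v ϖ ^ 2 := by
    intro i j
    have h := vDeep_frame_of_vDeep L H' w hw he ϖ hϖ A hA e heA δ hdeep i j
    rw [hγe] at h
    have hx : (((γ : GL (Fin 3) (w.1.adicCompletion L)) : Matrix (Fin 3) (Fin 3) (w.1.adicCompletion L)) - 1) i j =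
        ϖ * ϖ * (ϖ⁻¹ * (ϖ⁻¹ * ((((γ : GL (Fin 3) (w.1.adicCompletion L)) : Matrix (Fin 3) (Fin 3) (w.1.adicCompletion L)) - 1) i j))) := by
      field_simp
    rw [hx, map_mul, map_mul, ← pow_two]
    exact mul_le_of_le_one_right zero_le h
  rw [ncard_selfDual_fixed_levelZero_eq_card_mul_ncard_regularOne hσ hvσ hσϖ hϖ hres h2v hT γ hγ2,
    natCard_valuedResidueField_eq_of_ramified_CM L v w hw he, Ideal.absNorm_apply, Submodule.cardQuot_apply]

/-! ## §2 The (reg) row sockets, both parities -/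

set_option maxHeartbeats 1600000 in
/-- **ROW SOCKET (reg), Even depth** — EXACTLY the type of `stub_T2G_reg_even_ram` of the (Cnt2′) skeleton: per literal `δ`, `#S_reg(δ) · q_v = #S_bd(δ)` (the `γ_H`-keys,
discriminant, `κ` and matching binders are idle; §1 at `δ`). [cite: Rogawski1990, §4.9 Prop. 4.9.1 (a) p. 55] [cite: Kottwitz1986, §3] -/
theorem typeTwo_stratumReg_even_ram
    (L : Type) [Field L] [NumberField L] [IsCMField L] (H' : Matrix (Fin 3) (Fin 3) L)
    {v : HeightOneSpectrum (𝓞 ↥(maximalRealSubfield L))}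
    (_hH' : (H'.map (cmConjRingHom L)).transpose = H') (w : PlacesOver L v)
    (hw : IsCMField.complexConj L • w.1 = w.1) (he : v.asIdeal.ramificationIdx' w.1.asIdeal ≠ 1)
    (hH'w : IsUnit (placeForm H' w.1)) (_hH'i : hH'w.unit ∈ glInt 3 (w.1.adicCompletion L))
    (h2 : IsUnit (2 : 𝒪[(w.1.adicCompletion L)]))
    (ϖ : w.1.adicCompletion L) (hϖ : Valued.v ϖ = WithZero.exp (-1 : ℤ)) (hσϖ : galAdicCompletionMap (L := L) (IsCMField.complexConj L) hw ϖ = -ϖ)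
    (A : GL (Fin 3) (w.1.adicCompletion L)) (hA : A ∈ glInt 3 (w.1.adicCompletion L))
    (hframe : placeForm H' w.1 = (-(placeForm H' w.1).det) • formCongr (galAdicCompletionMap (L := L) (IsCMField.complexConj L) hw) A ((StdForm.antidiagonal 3).over (w.1.adicCompletion L))) :
    ∀ ⦃γH : ((cmDatum L 2 (Matrix.of fun i j : Fin 2 => if i.val + j.val + 1 = 2 then (1 : L) else 0)).Local v × (cmDatum L 1 (Matrix.of fun i j : Fin 1 => if i.val + j.val + 1 = 1 then (1 : L) else 0)).Local v)⦄,
      (∀ i j : Fin 2, Valued.v (((((γH.1.val : GL (Fin 2) (UnitaryGroup.LocalRing L v)).val.map (Pi.evalRingHom (fun w' : PlacesOver L v => w'.1.adicCompletion L) w))) - 1) i j) ≤ Valued.v (ϖ ^ 2)) → Valued.v (finGammaTwo L v γH w - 1) ≤ Valued.v (ϖ ^ 2) → IsLocalGRegular L v γH →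
      (¬ ∃ x : (w.1.adicCompletion L), ((((γH.1.val : GL (Fin 2) (UnitaryGroup.LocalRing L v)).val.map (Pi.evalRingHom (fun w' : PlacesOver L v => w'.1.adicCompletion L) w))).charpoly).IsRoot x) → ∀ ⦃n : ℕ⦄,
      Valued.v ((((γH.1.val : GL (Fin 2) (UnitaryGroup.LocalRing L v)).val.map (Pi.evalRingHom (fun w' : PlacesOver L v => w'.1.adicCompletion L) w))).trace ^ 2 - 4 * (((γH.1.val : GL (Fin 2) (UnitaryGroup.LocalRing L v)).val.map (Pi.evalRingHom (fun w' : PlacesOver L v => w'.1.adicCompletion L) w))).det) = WithZero.exp (-((2 * (2 * n) : ℕ) : ℤ)) → 1 ≤ n →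
      ∀ δ : ((cmDatum L 3 H').Local v), IsLocalNormPair L H' v γH δ → (finKappaAt L v H' γH δ = 1 ∨ finKappaAt L v H' γH δ = -1) →
        (∀ a b, Valued.v (((toPlace v w (HeckeCharacter.uniformizer ↥(maximalRealSubfield L) v : v.adicCompletion ↥(maximalRealSubfield L))) ^ 1)⁻¹ * ((((δ).val : GL (Fin 3) (UnitaryGroup.LocalRing L v)).val.map (Pi.evalRingHom (fun w' : PlacesOver L v => w'.1.adicCompletion L) w)) a b - (1 : Matrix (Fin 3) (Fin 3) (w.1.adicCompletion L)) a b)) ≤ 1) →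
        ({q : (((cmDatum L 3 H').Local v) ⧸ cmLocalIntegralLevel L 3 H' v) | q ∈ MulAction.fixedBy (((cmDatum L 3 H').Local v) ⧸ cmLocalIntegralLevel L 3 H' v) δ ∧ (redMat (((((q.out⁻¹ * δ * q.out)).val : GL (Fin 3) (UnitaryGroup.LocalRing L v)).val.map (Pi.evalRingHom (fun w' : PlacesOver L v => w'.1.adicCompletion L) w))) - 1).rank = 0 ∧ (redMat (ϖ⁻¹ • (((((q.out⁻¹ * δ * q.out)).val : GL (Fin 3) (UnitaryGroup.LocalRing L v)).val.map (Pi.evalRingHom (fun w' : PlacesOver L v => w'.1.adicCompletion L) w)) - 1))).rank = 2}.ncard : ℂ) * (Ideal.absNorm v.asIdeal : ℂ) =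
          ({q : (((cmDatum L 3 H').Local v) ⧸ cmLocalIntegralLevel L 3 H' v) | q ∈ MulAction.fixedBy (((cmDatum L 3 H').Local v) ⧸ cmLocalIntegralLevel L 3 H' v) δ ∧ (redMat (((((q.out⁻¹ * δ * q.out)).val : GL (Fin 3) (UnitaryGroup.LocalRing L v)).val.map (Pi.evalRingHom (fun w' : PlacesOver L v => w'.1.adicCompletion L) w))) - 1).rank = 2}.ncard : ℂ) := by
  intro γH _hblk _hu _hreg _hirr n _hN _hn1 δ _hδ _hκ hdeep
  have h := absNorm_mul_ncard_rankStratum_reg_eq_ncard_rankStratum_two_ram L H' w hw he hH'w h2 ϖ hϖ hσϖ A hA hframe δ hdeep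
  rw [mul_comm]
  exact_mod_cast h

set_option maxHeartbeats 1600000 in
/-- **ROW SOCKET (reg), Odd depth** — EXACTLY the type of `stub_T2G_reg_odd_ram` of the (Cnt2′) skeleton: per literal `δ`, `#S_reg(δ) · q_v = #S_bd(δ)` (idle binders as in
the even case; §1 at `δ`). [cite: Rogawski1990, §4.9 Prop. 4.9.1 (a) p. 55] [cite: Kottwitz1986, §3] -/
theorem typeTwo_stratumReg_odd_ram
    (L : Type) [Field L] [NumberField L] [IsCMField L] (H' : Matrix (Fin 3) (Fin 3) L)
    {v : HeightOneSpectrum (𝓞 ↥(maximalRealSubfield L))}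
    (_hH' : (H'.map (cmConjRingHom L)).transpose = H') (w : PlacesOver L v)
    (hw : IsCMField.complexConj L • w.1 = w.1) (he : v.asIdeal.ramificationIdx' w.1.asIdeal ≠ 1)
    (hH'w : IsUnit (placeForm H' w.1)) (_hH'i : hH'w.unit ∈ glInt 3 (w.1.adicCompletion L))
    (h2 : IsUnit (2 : 𝒪[(w.1.adicCompletion L)]))
    (ϖ : w.1.adicCompletion L) (hϖ : Valued.v ϖ = WithZero.exp (-1 : ℤ)) (hσϖ : galAdicCompletionMap (L := L) (IsCMField.complexConj L) hw ϖ = -ϖ)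
    (A : GL (Fin 3) (w.1.adicCompletion L)) (hA : A ∈ glInt 3 (w.1.adicCompletion L))
    (hframe : placeForm H' w.1 = (-(placeForm H' w.1).det) • formCongr (galAdicCompletionMap (L := L) (IsCMField.complexConj L) hw) A ((StdForm.antidiagonal 3).over (w.1.adicCompletion L))) :
    ∀ ⦃γH : ((cmDatum L 2 (Matrix.of fun i j : Fin 2 => if i.val + j.val + 1 = 2 then (1 : L) else 0)).Local v × (cmDatum L 1 (Matrix.of fun i j : Fin 1 => if i.val + j.val + 1 = 1 then (1 : L) else 0)).Local v)⦄,
      (∀ i j : Fin 2, Valued.v (((((γH.1.val : GL (Fin 2) (UnitaryGroup.LocalRing L v)).val.map (Pi.evalRingHom (fun w' : PlacesOver L v => w'.1.adicCompletion L) w))) - 1) i j) ≤ Valued.v (ϖ ^ 2)) → Valued.v (finGammaTwo L v γH w - 1) ≤ Valued.v (ϖ ^ 2) → IsLocalGRegular L v γH →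
      (¬ ∃ x : (w.1.adicCompletion L), ((((γH.1.val : GL (Fin 2) (UnitaryGroup.LocalRing L v)).val.map (Pi.evalRingHom (fun w' : PlacesOver L v => w'.1.adicCompletion L) w))).charpoly).IsRoot x) → ∀ ⦃n : ℕ⦄,
      Valued.v ((((γH.1.val : GL (Fin 2) (UnitaryGroup.LocalRing L v)).val.map (Pi.evalRingHom (fun w' : PlacesOver L v => w'.1.adicCompletion L) w))).trace ^ 2 - 4 * (((γH.1.val : GL (Fin 2) (UnitaryGroup.LocalRing L v)).val.map (Pi.evalRingHom (fun w' : PlacesOver L v => w'.1.adicCompletion L) w))).det) = WithZero.exp (-((2 * (2 * n + 1) : ℕ) : ℤ)) → 1 ≤ n →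
      ∀ δ : ((cmDatum L 3 H').Local v), IsLocalNormPair L H' v γH δ → (finKappaAt L v H' γH δ = 1 ∨ finKappaAt L v H' γH δ = -1) →
        (∀ a b, Valued.v (((toPlace v w (HeckeCharacter.uniformizer ↥(maximalRealSubfield L) v : v.adicCompletion ↥(maximalRealSubfield L))) ^ 1)⁻¹ * ((((δ).val : GL (Fin 3) (UnitaryGroup.LocalRing L v)).val.map (Pi.evalRingHom (fun w' : PlacesOver L v => w'.1.adicCompletion L) w)) a b - (1 : Matrix (Fin 3) (Fin 3) (w.1.adicCompletion L)) a b)) ≤ 1) →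
        ({q : (((cmDatum L 3 H').Local v) ⧸ cmLocalIntegralLevel L 3 H' v) | q ∈ MulAction.fixedBy (((cmDatum L 3 H').Local v) ⧸ cmLocalIntegralLevel L 3 H' v) δ ∧ (redMat (((((q.out⁻¹ * δ * q.out)).val : GL (Fin 3) (UnitaryGroup.LocalRing L v)).val.map (Pi.evalRingHom (fun w' : PlacesOver L v => w'.1.adicCompletion L) w))) - 1).rank = 0 ∧ (redMat (ϖ⁻¹ • (((((q.out⁻¹ * δ * q.out)).val : GL (Fin 3) (UnitaryGroup.LocalRing L v)).val.map (Pi.evalRingHom (fun w' : PlacesOver L v => w'.1.adicCompletion L) w)) - 1))).rank = 2}.ncard : ℂ) * (Ideal.absNorm v.asIdeal : ℂ) =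
          ({q : (((cmDatum L 3 H').Local v) ⧸ cmLocalIntegralLevel L 3 H' v) | q ∈ MulAction.fixedBy (((cmDatum L 3 H').Local v) ⧸ cmLocalIntegralLevel L 3 H' v) δ ∧ (redMat (((((q.out⁻¹ * δ * q.out)).val : GL (Fin 3) (UnitaryGroup.LocalRing L v)).val.map (Pi.evalRingHom (fun w' : PlacesOver L v => w'.1.adicCompletion L) w))) - 1).rank = 2}.ncard : ℂ) := by
  intro γH _hblk _hu _hreg _hirr n _hN _hn1 δ _hδ _hκ hdeep
  have h := absNorm_mul_ncard_rankStratum_reg_eq_ncard_rankStratum_two_ram L H' w hw he hH'w h2 ϖ hϖ hσϖ A hA hframe δ hdeep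
  rw [mul_comm]
  exact_mod_cast h

end Literature.NumberTheory.Rogawski1990

end
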